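import Literature.NumberTheory.EllipticCurves.YanZhu2026.TwoVariableMainTheorems
import HarnessLib

/-!
# Yan–Zhu 2026 (J. Algebra 693 = arXiv:2412.20078v4), §3.2 Theorem 3.3 (= Castella–Grossi–Skinner
# 2025, Thm. 2.2.1; "a reformulation of [PR88, Thm. 1.1] following Hida's `p`-adic Rankin method") —
# the EXISTENCE of Hida's type-I two-variable `p`-adic Rankin–Selberg function `𝓛_p^I(f/K) ∈ c_f⁻¹Λ_K`
# as a STANDALONE named fact, for the newform of an elliptic curve

Source and locators: X. Yan, X. Zhu, *Main conjectures for non-CM elliptic curves at good ordinary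
primes*, J. Algebra **693** (2026) 372–402 = arXiv:2412.20078v4 (TeX of record
`run/shared/lean/b2b/bsd-rank1-residual/b2b-bsdres-lit/g98/eprints/yz_v4/main.tex`): §2 setting
l.440–442 ("`K` an imaginary quadratic field with discriminant `D_K`, … `p > 2` a prime that splits in
`K`, say `p𝒪_K = 𝔭𝔭̄` … `K_∞` the `ℤ_p²`-extension of `K`"), §2.1 l.468 ("`E/ℚ` an elliptic curve of
conductor `N` with `(N, D_K) = 1`. We assume that `E` has good ordinary reduction at `p`"), §3.2
l.738–752 (**Thm. 3.3**, verbatim below), l.755 ("`E/ℚ` an elliptic curve with good ordinary reduction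
at the prime `p`. Let `f_E ∈ S₂(Γ₀(N))` denote the newform associated with `E`"); = arXiv v2 Thm. 3.3
[corpus:paper:arxiv-2412.20078 p0009]. Bib key `YanZhu2024MainConjNonCM`.

Written by the typer seat `bsd-littype-01` (gen 7) of the cross-ladder literature-typing layer
(D-0088(4); cell `run/shared/lean/pub/bsd-littype/`), as a COMPANION of seat `bsd-littype-04`'s
`YanZhu2026/TwoVariableMainTheorems.lean` (theirs untouched): that file defines the characterising
predicate `IsHidaRankinLFunction ι W κ₁ κ₂ f F` (the printed interpolation property, reading flag
`YZ-33-range`) and `IsCongruenceIntegral f F` ("`∈ c_f⁻¹Λ_K`"), and asserts the printed EXISTENCE of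
Thm. 3.3 only INSIDE the Heegner-locus facts `thm42_…` / `cor46_…` (and BCS25's `thm141_…`). Off the
Heegner locus — e.g. on the (def)/(indef) locus of Burungale–Skinner–Tian–Wan's Thm. 10.10 (b)
(`BurungaleSkinnerTianWan2024.thm1010b_standardMainStatement_twoVariable_OPEN`, which quantifies over
EVERY `F` of the frame) — consumers need the existence of a frame element by itself; Thm. 3.3 is that
refereed statement, with NO Heegner hypothesis, NO irreducibility, NO image condition. ONE named fact
(REFEREED, published; D-0014: nothing proved, no `_holds` expected — Hida's `p`-adic Rankin–Selberg
method is not in the tree), no new notion; the E-instance read-outs (parametrisation form, ∀-frame ⟹ ∃-frame) live with their consumers (Summits-side edges).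

## The printed statement (v4 l.738–752, verbatim)

"Let `f = Σ a_n qⁿ ∈ S₂(Γ₀(N))` be a newform with `p ∤ a_p`, and let `c_f ∈ ℤ_p` be the congruence
number associated with `f` as defined in [Hida81, Section 7] or [Rib83]. **Theorem 3.3.** There exists
an element `𝓛_p^I(f/K) ∈ c_f⁻¹Λ_K` such that for every finite-order nontrivial character `ξ` of `Γ_K` of
conductor `𝔭^m𝔭̄^n` with `m + n > 0`, we have `𝓛_p^I(f/K)(ξ) = W(ξ) p^{ord_p(Nm(𝔣_ξ))/2}
α_p^{−ord_p(Nm(𝔣_ξ))} (1 − p/α_p²)⁻¹ (1 − 1/α_p²)⁻¹ · L(f/K, ξ⁻¹, 1)/(8π²⟨f,f⟩)`, where `α_p` is the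
`p`-adic unit root of the polynomial `x² − a_p x + p`, `⟨f,g⟩ = ∫_{Γ₀(N)\𝓗} \overline{f(τ)} g(τ) dτ`
denotes the Petersson inner product on `S₂(Γ₁(N))`, and `W(ξ)` is the Artin root number. Proof. This
is a reformulation of [PR88, Theorem 1.1] following Hida's `p`-adic Rankin method [Hida85], as given in
[CGS, Theorem 2.2.1]."

## Transcription (verbatim the sibling's, `TwoVariableMainTheorems.lean` module docstring)

`K` imaginary quadratic with two primes over the odd prime `p` (§2); `W` a globally minimal model of
`E/ℚ` (the predicate reads `α_p` as `unitRoot W p`), `p` good ordinary for `W` (`GoodOrd W p`: `p ∤ N`,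
`p ∤ a_p` — "newform with `p ∤ a_p`" for `f = f_E`), `f` a newform of `W` at level `N` (`IsNewformOf W
f`) with `N` the conductor and `(N, D_K) = 1` (§2.1); `Γ_K` through ANY pair `(κ₁, κ₂)` of
`ℤ_p`-extensions of `K` with adapted generators `(γ₁, γ₂)` (the predicate evaluates `F` at
`(ξ(γ₁) − 1, ξ(γ₂) − 1)` for the finite-order characters `ξ = pairCharacter κ₁ κ₂ n e₁ e₂`; existence in
one coordinate system is existence in all, `Λ_K = ℤ_p⟦Γ_K⟧`); `ι` an embedding datum. CONCLUSION:
`∃ F : CycAntiSeries p, IsHidaRankinLFunction ι W κ₁ κ₂ f F ∧ IsCongruenceIntegral f F`. WEAKER-OR-EQUAL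
to print: the E-case of "newform `f`" (`-- TODO(general form)` below); the interpolation is demanded
on the sub-range `m, n > 0` (flag `YZ-33-range` of the predicate); `c_f ↦ congruenceNumber f`
(Agashe–Ribet–Stein's `r_f ∈ ℕ`, = the printed `c_f ∈ ℤ_p` up to a `p`-adic unit — the sibling's
reading). Never stronger.

CONSUMERS: the ∃-form two-variable leaf
`Summit.BirchSwinnertonDyer.Rank1Residual.TwoVariableIMC.OrdinaryTwoVariableMainConjectureAt` (which asks
for such an `F`) on loci where only ∀-frame statements are typed (BSTW Thm. 10.10 (b)); `bsd-cn100` /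
K3 cells using `perrinRiouLFunction W π F` off the Heegner locus.

## References
* [YanZhu2024MainConjNonCM] J. Algebra 693 (2026) = arXiv:2412.20078v4, Thm. 3.3 (l.738–752) with §2
  (l.440–442), §2.1 (l.468), §3.2 (l.755); = v2 Thm. 3.3 [corpus:paper:arxiv-2412.20078 p0009].
* [CastellaGrossiSkinner2025] Math. Ann. 393 (2025), Thm. 2.2.1 (the source's source).
* [PerrinRiou1988] B. Perrin-Riou, J. London Math. Soc. (2) 38 (1988), Thm. 1.1; H. Hida, Invent.
  Math. 79 (1985) (the method) — as cited by the source.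
-/

noncomputable section

open scoped Classical

open PowerSeries NumberField IsDedekindDomain Field CongruenceSubgroup
  Literature.NumberTheory.GaloisRepresentations Literature.NumberTheory.EllipticCurves
  Literature.NumberTheory.EllipticCurves.ModularForms Literature.NumberTheory.EllipticCurves.Rank1Residual

namespace Literature.NumberTheory.EllipticCurves.YanZhu2026

open IwasawaAlgebra₂

/-- **Yan–Zhu, J. Algebra 693 (2026), Theorem 3.3 (arXiv v4 l.738–752; = [CGS, Thm. 2.2.1]; "a
reformulation of [PR88, Thm. 1.1] following Hida's `p`-adic Rankin method") — EXISTENCE of Hida's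
type-I two-variable `p`-adic Rankin–Selberg function `𝓛_p^I(f/K) ∈ c_f⁻¹Λ_K`, for the newform of an
elliptic curve.** Verbatim: "Let `f ∈ S₂(Γ₀(N))` be a newform with `p ∤ a_p` … There exists an element
`𝓛_p^I(f/K) ∈ c_f⁻¹Λ_K` such that for every finite-order nontrivial character `ξ` of `Γ_K` of conductor
`𝔭^m𝔭̄^n` with `m + n > 0`, we have `𝓛_p^I(f/K)(ξ) = W(ξ) p^{ord_p(Nm(𝔣_ξ))/2} α_p^{−ord_p(Nm(𝔣_ξ))}
(1 − p/α_p²)⁻¹(1 − 1/α_p²)⁻¹ L(f/K, ξ⁻¹, 1)/(8π²⟨f,f⟩)`". Setting (§2 l.440–442, §2.1 l.468, §3.2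
l.755): `K` imaginary quadratic, `p > 2` split in `K`, `E/ℚ` of conductor `N` with `(N, D_K) = 1` and
good ordinary reduction at `p`, `f = f_E`. Transcription (module docstring): `W` a globally minimal
model of `E` of conductor `N`, `f` a newform of `W` at level `N`, `3 ≤ p`, `GoodOrd W p`,
`IsImaginaryQuadratic K`, two primes of `𝓞 K` over `p`, `IsCoprime N D_K`; `Γ_K` through any adapted
`(κ₁, κ₂; γ₁, γ₂)`; `ι` an embedding datum; conclusion: some `F ∈ ℚ_p⟦T⟧⟦S⟧` satisfies the sibling's
characterising predicate `IsHidaRankinLFunction ι W κ₁ κ₂ f F` (flag `YZ-33-range`: WEAKER) and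
`IsCongruenceIntegral f F` ("`∈ c_f⁻¹Λ_K`", `c_f ↦ congruenceNumber f`). The STANDALONE form of the
existence bundled in `thm42_XOrd₂_isTorsion_charIdeal_le_perrinRiou` / `cor46_…` /
`BurungaleCastellaSkinner2025.thm141_…` — here with NO Heegner hypothesis, NO irreducibility, NO image
condition (none is printed for Thm. 3.3). PUBLISHED, refereed; proof = Hida's `p`-adic Rankin–Selberg
method (not in the tree; no `_holds` expected).
-- TODO(general form): an arbitrary `p`-ordinary newform `f ∈ S₂(Γ₀(N))` (the tree's predicate reads `α_p` through an elliptic curve `W`).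
[cite: YanZhu2024MainConjNonCM, Thm. 3.3 (§3.2, arXiv:2412.20078v4 TeX l.738–752) with the setting §2 l.440–442, §2.1 l.468, §3.2 l.755; = arXiv v2 Thm. 3.3 [corpus:paper:arxiv-2412.20078 p0009]]
[cite: CastellaGrossiSkinner2025, Thm. 2.2.1 (the statement Yan–Zhu reformulate)] -/
def thm33_exists_isHidaRankinLFunction : Prop :=
  ∀ {p : ℕ} [Fact p.Prime] (ι : integralClosure ℚ ℂ →+* ℂ_[p]) (W : WeierstrassCurve ℚ) [W.IsElliptic]
    [W.IsGloballyMinimal] (K : Type) [Field K] [NumberField K] (κ₁ κ₂ : ZpExtension K p)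
    (γ₁ γ₂ : absoluteGaloisGroup K) [Fact (ZpExtension.IsTopGeneratorPair κ₁ κ₂ γ₁ γ₂)]
    {N : ℕ} [NeZero N] {f : CuspForm (Gamma0 N) 2} (_ : IsNewformOf W f),
    (N : ℤ) = W.conductorNorm ℤ → 3 ≤ p → GoodOrd W p → IsImaginaryQuadratic K →
      ((Ideal.span {(p : ℤ)}).primesOver (𝓞 K)).ncard = 2 →
      IsCoprime (N : ℤ) (NumberField.discr K) →
    ∃ F : CycAntiSeries p, IsHidaRankinLFunction ι W κ₁ κ₂ f F ∧ IsCongruenceIntegral f F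

/-! ### Unfolding -/

/-- Unfolding lemma (the fact is the displayed `∀ … ∃ F, …`). [cite: YanZhu2024MainConjNonCM, Thm. 3.3 (arXiv:2412.20078v4 TeX l.738–752)] -/
theorem thm33_exists_isHidaRankinLFunction_iff :
    thm33_exists_isHidaRankinLFunction ↔
      ∀ {p : ℕ} [Fact p.Prime] (ι : integralClosure ℚ ℂ →+* ℂ_[p]) (W : WeierstrassCurve ℚ)
        [W.IsElliptic] [W.IsGloballyMinimal] (K : Type) [Field K] [NumberField K]
        (κ₁ κ₂ : ZpExtension K p) (γ₁ γ₂ : absoluteGaloisGroup K)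
        [Fact (ZpExtension.IsTopGeneratorPair κ₁ κ₂ γ₁ γ₂)] {N : ℕ} [NeZero N]
        {f : CuspForm (Gamma0 N) 2} (_ : IsNewformOf W f),
        (N : ℤ) = W.conductorNorm ℤ → 3 ≤ p → GoodOrd W p → IsImaginaryQuadratic K →
          ((Ideal.span {(p : ℤ)}).primesOver (𝓞 K)).ncard = 2 →
          IsCoprime (N : ℤ) (NumberField.discr K) →
        ∃ F : CycAntiSeries p, IsHidaRankinLFunction ι W κ₁ κ₂ f F ∧ IsCongruenceIntegral f F :=
  Iff.rfl

end Literature.NumberTheory.EllipticCurves.YanZhu2026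

end
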